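import Summits.Ventures.CertifiedManyBodySolver.Certificates.HubbardSquare_tpm3o10_U29o5_toyKernelCert_bondRowQuot
import Summits.Ventures.CertifiedManyBodySolver.Rows.CorrWindowCertKernelChainQuotAdjNearCloser
import Summits.Ventures.CertifiedManyBodySolver.Rows.CARPolyWindowGramContractPairs
import HarnessLib

/-!
# STEP-0 of the FULL LANE OF RECORD: contracted Gram (word table + partner table, copy lists derived, three checks by `decide`) →
# eom-NEAR residual slices → hinted-quotient + adjoint chain `stepEQA` → the closer of record `…GNear` — the `↓` bond row at
# `(1, −3/10, 29/5)` read at `n₀ = 1` (value `−1`, slope `−1`) — ZERO hypotheses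

HONEST FRAMING: a TOY and THE TEMPLATE for the exporter's first prefix instance (HOME/STATUS «(R0′) RESOLVED» 23:33:13Z): the bond
certificate of `…_bondRowQuot` (`muq`, `Dq`, `dΛq`, one translation hint) with its single Gram block presented as a WORD TABLE
`wordsq = [(v := a_{0↓}+a_{e₁↓}, memberships [(copy 0, row [1])])]` and a PARTNER TABLE `Qq = [(0, [0])]` (`Rows/CARPolyWindowGramContract{,Pairs}.lean`):
the kernel derives the copy list, checks `rangeB`/`sortedB`/`countB`, contracts (trivially: one copy) and multiplies the pair once; the
residual is sliced with `residTGslicesNear` (no eom generators ⇒ empty masks, `eomFarOK` vacuous), the chain is `stepEQA` (hint accepted;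
adjoint pass idle on a Hermitian objective), and the closer is `affineOrbitLowerRowN_of_quotAdjChainKernelCertGNear` with
`hTG := termOp_flatten_gramContractSlices …`. Conclusion read at `n₀ = 1` so the statement is new (value `q = −1`). Trust base: the Lean
kernel (std axioms). No number of record; no existing claim node discharged; CONTROL/CALIBRATION context (wording (xx1)); silent on
ρ_s = 0 / presence / T_c / phase; nothing about La₂CuO₄; no summit statement is proved by this file. Seat hubbard-obs-p2 (STIFFNESS),
`prover-hubbard-obs-p2-g23-0`, zero compute.

References: X. Han, arXiv:2006.06002 §3 [Han2020Bootstrap]; J. Wang et al., PRX 14 (2024) 031006 §III [WangEtAl2024];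
C. Jansson, D. Chaykin, C. Keil, SIAM J. Numer. Anal. 46 (2008) 180 [JanssonChaykinKeil2008].
-/

namespace Summit.Ventures.CertifiedManyBodySolver

namespace CARPolyWindow

namespace Toy3x3

open Summit.Ventures.CertifiedQuantumChemistry Summit.Ventures.CertifiedQuantumChemistry.CARPoly
open Literature.MathematicalPhysics.QuantumLattice Literature.MathematicalPhysics.QuantumLattice.HubbardWave0
open Literature.MathematicalPhysics.QuantumManyBody.StateRelaxation
open Literature.Probability.LatticeModels ThermodynamicLimit Filter Topology
open Matrix
open scoped ComplexOrder BigOperators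

/-! ## The contracted-Gram data (word table + partner table) and the eom-near residual slices -/

/-- The WORD TABLE: one raw basis polynomial `v = a_{0↓} + a_{e₁↓}` in ONE copy (copy `0`, integer row `[1]`, `K = 0`).
[cite: Han2020Bootstrap, §2 eq. (2)] -/
def wordsq : WordTable (Orb (Fin 9)) := [([([(orb 0 1, false)], 1), ([(orb 1 1, false)], 1)], [(0, [1])])]

/-- The PARTNER TABLE: word `0` pairs with word `0` (the kernel derives the copy list `[0]`). [folklore] -/
def Qq : List (ℕ × List ℕ) := [(0, [0])]

/-- The three facts of the contraction, decided by the kernel. [folklore] -/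
theorem wordsq_checks : (rangeB wordsq 1 Qq && sortedB wordsq.length 1 (pairsOf wordsq Qq) && countB wordsq 1 (pairsOf wordsq Qq)) = true := by
  decide

/-- The eom-near residual slices (no eom generators here ⇒ no masks), regrouped `[1, 1 | rest]` into 3 chain slices.
[cite: WangEtAl2024, §III] -/
def toyGSlices : List (Terms (Orb (Fin 9))) :=
  groupSlices (residTGslicesNear TXq muq 0 (fun σ => orb (ix 0) σ) 0 0 0 0 TE (gramContractSlices 0 wordsq (pairsOf wordsq Qq)) TH Dq.f [] []
    (fun l : Fin 0 => l.elim0) (fun l : Fin 0 => l.elim0) [] []) [1, 1]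

/-- The hint lists: ONE translation hint on the Gram slice. [cite: Han2020Bootstrap, §3] -/
def toyGHints : List (List (QHint 1)) := [[], [⟨0, (1, 0), ([orb 0 1], [orb 0 1])⟩], []]

/-! ## The accumulators (elaboration-time literals) and the per-step KERNEL facts -/

/-- Accumulator after step 1 (head slice): `eval%` literal. [folklore] -/
def toyGC1 : SOSDual.EncPoly := eval% stepEQA Dq 32 ([] : SOSDual.EncPoly) (toyGSlices.getD 0 []) (toyGHints.getD 0 [])

/-- Accumulator after step 2 (the Gram slice, quotiented by the accepted hint): `eval%` literal. [folklore] -/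
def toyGC2 : SOSDual.EncPoly := eval% stepEQA Dq 32 toyGC1 (toyGSlices.getD 1 []) (toyGHints.getD 1 [])

/-- Accumulator after step 3 (empty tail): `eval%` literal. [folklore] -/
def toyGC3 : SOSDual.EncPoly := eval% stepEQA Dq 32 toyGC2 (toyGSlices.getD 2 []) (toyGHints.getD 2 [])

/-- The accumulator list. [folklore] -/
def toyGCs : List SOSDual.EncPoly := [[], toyGC1, toyGC2, toyGC3]

/-- KERNEL FACT, step 1 of 3. [folklore] -/
theorem toyG_step_0 : toyGCs.getD (0 + 1) [] = stepEQA Dq 32 (toyGCs.getD 0 []) (toyGSlices.getD 0 []) (toyGHints.getD 0 []) :=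
  eq_of_beq (by decide +kernel)

/-- KERNEL FACT, step 2 of 3 (contracted Gram slice; hint applied). [folklore] -/
theorem toyG_step_1 : toyGCs.getD (1 + 1) [] = stepEQA Dq 32 (toyGCs.getD 1 []) (toyGSlices.getD 1 []) (toyGHints.getD 1 []) :=
  eq_of_beq (by decide +kernel)

/-- KERNEL FACT, step 3 of 3. [folklore] -/
theorem toyG_step_2 : toyGCs.getD (2 + 1) [] = stepEQA Dq 32 (toyGCs.getD 2 []) (toyGSlices.getD 2 []) (toyGHints.getD 2 []) :=
  eq_of_beq (by decide +kernel)

/-- **The hinted chain record**, assembled by pattern matching on `Fin 3`. [cite: JanssonChaykinKeil2008, §3] -/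
theorem toyG_chain_ok : ChainQAOK Dq 32 3 toyGCs toyGSlices toyGHints where
  len := by decide +kernel
  step i := match i with
    | ⟨0, _⟩ => toyG_step_0
    | ⟨1, _⟩ => toyG_step_1
    | ⟨2, _⟩ => toyG_step_2
    | ⟨n + 3, h⟩ => absurd h (by omega)

/-- Everything cancels: the last accumulator is EMPTY. Decided by the kernel. [folklore] -/
theorem toyG_last_nil : toyGCs.getD 3 [] = [] := by decide +kernel

/-- **The ONE rational inequality on the last accumulator**, read at `n₀ = 1`: `−1 ≤ lowerConst (decPoly 9 C₃) + (μ_↑ + μ_↓)(1/2 − 0)`.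
[cite: WangEtAl2024, §III] -/
theorem toyG_lowerConst :
    (-1 : ℚ) ≤ lowerConst (SOSDual.decPoly 9 (toyGCs.getD 3 [])) + (muq 0 + muq 1) * ((1 : ℚ) / 2 - 0) := by
  decide +kernel

/-! ## The end-to-end theorem -/

/-- Membership-proof irrelevance for ordered sites. [folklore] -/
private theorem pt_congr_site₉ {V : Finset (Site 2)} {x y : Site 2} (hx : x ∈ V) (hy : y ∈ V) (h : x = y) :
    PolySite.pt x hx = PolySite.pt y hy := by
  subst h; rfl

/-- **STEP-0 of the full lane of record: the affine-N claim-node predicate for the `↓` bond word at `(1, −3/10, 29/5)`, read at `n₀ = 1`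
(value `−1`, slope `−1`), orbit set `{1}` — contracted Gram + eom-near slices + `stepEQA` + the `…GNear` closer, ZERO hypotheses.**
[cite: WangEtAl2024, §III] [cite: Han2020Bootstrap, §3] -/
theorem toyG_affineOrbitLowerRowN :
    SquareTTPrimeCorrAffineOrbitLowerRowN (((-3 / 10 : ℚ)) : ℝ) (((29 / 5 : ℚ)) : ℝ) (-1) 0 0 0 0 (-1) 1 {1} W
      (termOp d TXq) := by
  have hz : (0 : Site 2) ∈ W := zero_mem_thicken_zero 1
  have h1 : (1 : DihedralGroup 4) ∈ ({1} : Finset (DihedralGroup 4)) := Finset.mem_singleton_self 1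
  have hmul : ∀ a ∈ ({1} : Finset (DihedralGroup 4)), ∀ b ∈ ({1} : Finset (DihedralGroup 4)),
      a * b ∈ ({1} : Finset (DihedralGroup 4)) := by
    intro a ha b hb
    rw [Finset.mem_singleton] at ha hb ⊢
    rw [ha, hb, mul_one]
  have hΛ : ({0} : Finset (Site 2)) ⊆ W := Finset.singleton_subset_iff.2 hz
  have hx0 : xs 0 = 0 := xs_zero
  have hix0 : xs (ix 0) = 0 := xs_ix_of_mem 0 hz
  have ho : ∀ σ : Fin 2, d (orb (ix 0) σ) = orb (PolySite.pt 0 hz) σ := by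
    intro σ
    rw [d_orb, pt_congr_site₉ (xs_mem (ix 0)) hz hix0]
  have hxsβ : ∀ j : Fin 1, Dq.xsβ j ∈ ({0} : Finset (Site 2)) := fun _ => Finset.mem_singleton_self 0
  have hcovβ : ∀ x ∈ ({0} : Finset (Site 2)), ∃ j : Fin 1, Dq.xsβ j = x := by
    intro x hx
    rw [Finset.mem_singleton] at hx
    exact ⟨0, hx.symm⟩
  have hdΛ : ∀ (j : Fin 1) (σ : Fin 2), dΛq (orb j σ) = orb (PolySite.pt (Dq.xsβ j) (hxsβ j)) σ := fun _ _ => rfl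
  have hf : ∀ b : Orb (Fin 1), d (Dq.f b) = Orb.embMap (PolySite.incl hΛ) (dΛq b) := by
    intro b
    show d (orb 0 (ofLex b).2) = _
    rw [d_orb, pt_congr_site₉ (xs_mem 0) (hΛ (Finset.mem_singleton_self 0)) hx0]
    rfl
  have hokS : ∀ (γc : Fin 8) (v : ℤ × ℤ), Dq.ok γc v = true → d4OfCode γc ∈ ({1} : Finset (DihedralGroup 4)) := by
    intro γc v h
    have h' : γc = 0 ∧ v = ((1 : ℤ), (0 : ℤ)) := of_decide_eq_true h
    rw [h'.1]
    exact h1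
  have hokV : ∀ (γc : Fin 8) (v : ℤ × ℤ), Dq.ok γc v = true → ∀ j : Fin 1,
      Dq.xs (Dq.ix (d4Vec (d4OfCode γc) (Dq.xsβ j) + siteOfPair v)) = d4Vec (d4OfCode γc) (Dq.xsβ j) + siteOfPair v := by
    intro γc v h j
    have h' : γc = 0 ∧ v = ((1 : ℤ), (0 : ℤ)) := of_decide_eq_true h
    obtain ⟨rfl, rfl⟩ := h'
    revert j
    decide
  have hH : termOp d TH = (hubbardTTPrimeFermionInteraction 1 (((-3 / 10 : ℚ)) : ℝ) (((29 / 5 : ℚ)) : ℝ)).localHamiltonian W := by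
    rw [TH, termOp_hamTermsIdx 1 (-3 / 10) (29 / 5) xs xs_mem xs_injective xs_cover d d_orb, Rat.cast_one]
  have hE : termOp d TE = fermionEmbed (PolySite.incl (subset_refl W))
      ((hubbardTTPrimeFermionInteraction 1 (((-3 / 10 : ℚ)) : ℝ) (((29 / 5 : ℚ)) : ℝ)).meanEnergyObs 1) := by
    rw [TE, termOp_energyTermsIdx 1 (-3 / 10) (29 / 5) xs xs_mem (subset_refl W) ix xs_ix_of_mem d d_orb, Rat.cast_one]
  have hchk := wordsq_checks
  simp only [Bool.and_eq_true] at hchk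
  have hTG := termOp_flatten_gramContractSlices (d := d) 0 wordsq 1 (pairsOf wordsq Qq) (validP_pairsOf wordsq 1 Qq hchk.1.1)
    (sortedP_of_sortedB _ _ _ hchk.1.2) (countP_of_countB _ _ _ hchk.2)
  exact affineOrbitLowerRowN_of_quotAdjChainKernelCertGNear (-3 / 10) (29 / 5) (by norm_num) hΛ (subset_refl W) (subset_refl W) hz h1
    hmul Dq xs_mem xs_ix_of_mem hxsβ hcovβ d d_injective d_orb 32 dΛq hdΛ hf (fun p => (ofLex p).2) (fun _ => rfl) hokS hokV
    TH hH TE hE (fun σ => orb (ix 0) σ) ho TXq muq 0 0 0 0 0 (gramContractSlices 0 wordsq (pairsOf wordsq Qq))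
    (gramTBCoef_posSemidef 0 (copyBlocks wordsq 1)) (gramTBOp d (copyBlocks wordsq 1)) hTG [] [] (by decide)
    [] (fun wc hwc => absurd hwc List.not_mem_nil) [] [1, 1] 3 toyGCs rfl toyGHints toyG_chain_ok (by norm_num [muq]) toyG_lowerConst

end Toy3x3

end CARPolyWindow

end Summit.Ventures.CertifiedManyBodySolver
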